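import Summits.ValiantsHypothesis.ValiantsHypothesis.Theses.BorderApolarity
import Summits.ValiantsHypothesis.ValiantsHypothesis.Theorems.BorderApolarityToricFixedPointsToricLimitIsInitialAux1
import Summits.ValiantsHypothesis.ValiantsHypothesis.Theorems.BorderApolarityFixedWitnessObstructionQPKuratowskiSubmodule
import Summits.ValiantsHypothesis.ValiantsHypothesis.Theorems.BorderApolarityFixedWitnessObstructionQPAnnSubmodule
import Literature.Computability.AlgebraicComplexity.Apolarity

/-!
# `ToricFixedPoints` — negative-side lemma: the character clause of `H₀(n,m)` is NOT load-bearing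

Crux `Summit.ValiantsHypothesis.ValiantsHypothesis.Theses.BorderApolarity.ToricFixedPoints`
(stmt-ValiantsHypothesis-5779).  Its stability hypothesis W4 quantifies over the invertible matrices
`M` with (a) `M j i ≠ 0 → rk j ≤ rk i`, (b) own columns diagonal, (c) rank-one pattern on the
`Y`-diagonal and (d) the CHARACTER condition `M₀₀^(m-n) · ∏_{i ∈ Y} M_{(i,i)(i,i)} = 1`.
`h0Stable_without_character` shows that for the sets `J k` the crux speaks about (each `J k`,
`k ≤ m`, a linear subspace of degree-`k` forms — automatic for Kuratowski limits,
`h0Stable_without_character_of_isBorderApolarLimit`) W4 already gives stability under every `M`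
satisfying (a)–(c) only: rescale `M ↦ c • M` with `c^m · χ(M) = 1` (`χ(M) ≠ 0` because an own
column of an invertible `M` is its diagonal entry), and `linSubst (c • M)ᵀ D = c^k • linSubst Mᵀ D`
on degree-`k` forms.  Consequently the variant of the crux whose fixedness hypothesis drops (d)
(fixed points of the FULL torus `T̃ = {ℓ ↦ eℓ, Y_ij ↦ a_i b_j Y_ij}` times the `z`-Borel, no
character) has exactly the same fixed points: clause (d) is cosmetic — provers may use full
`T̃`-stability (e.g. `ℓ ↦ e ℓ` alone), planners may delete (d).  Refuter cdisprove unit, cycle 3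
(`Cruxes/ToricFixedPoints/Disproof.lean` §6). [folklore]
-/

namespace Summit.ValiantsHypothesis.Cruxes.ToricFixedPoints.Negative

open Literature.Computability.AlgebraicComplexity
open Summit.ValiantsHypothesis.ValiantsHypothesis.Theorems.BorderApolarityToricFixedPoints
open Summit.ValiantsHypothesis.ValiantsHypothesis.Theorems.BorderApolarityFixedWitnessObstructionQP
open scoped BigOperators Matrix
open Filter MvPolynomial

/-- A scalar substitution multiplies a degree-`k` form by `c^k`: `linSubst (c • 1) D = c^k • D`.
[folklore] -/
theorem linSubst_smul_one_of_isHomogeneous {σ : Type*} [Fintype σ] [DecidableEq σ] (c : ℂ)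
    {D : MvPolynomial σ ℂ} {k : ℕ} (hD : D.IsHomogeneous k) :
    linSubst σ ℂ (c • (1 : Matrix σ σ ℂ)) D = c ^ k • D := by
  rw [Matrix.smul_one_eq_diagonal]
  ext d
  rw [tli_coeff_linSubst_diagonal, coeff_smul, smul_eq_mul]
  by_cases hd : coeff d D = 0
  · rw [hd, mul_zero, mul_zero]
  · have hdeg : ∑ i ∈ d.support, d i = k := by
      have := hD hd
      rw [← this, Finsupp.weight_apply, Finsupp.sum]
      simp
    rw [Finset.prod_pow_eq_pow_sum, hdeg]

/-- A scaled substitution on degree-`k` forms: `linSubst (c • A) D = c^k • linSubst A D`. [folklore] -/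
theorem linSubst_smul_of_isHomogeneous {σ : Type*} [Fintype σ] [DecidableEq σ] (c : ℂ)
    (A : Matrix σ σ ℂ) {D : MvPolynomial σ ℂ} {k : ℕ} (hD : D.IsHomogeneous k) :
    linSubst σ ℂ (c • A) D = c ^ k • linSubst σ ℂ A D := by
  have h : c • A = (c • (1 : Matrix σ σ ℂ)) * A := by rw [smul_mul_assoc, one_mul]
  rw [h, linSubst_mul, AlgHom.comp_apply,
    linSubst_smul_one_of_isHomogeneous c (linSubst_isHomogeneous A hD)]

/-- For `n ≤ m` the `Y`-diagonal index set `{i : Fin m | m - n ≤ i}` has `n` elements. [folklore] -/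
theorem card_filter_block (n m : ℕ) (h : n ≤ m) :
    (Finset.univ.filter fun i : Fin m => m - n ≤ (i : ℕ)).card = n := by
  have := card_blockIdx (n := n) (m := m) h
  rwa [Fintype.card_subtype] at this

/-- **Clause (d) of `H₀` is not load-bearing.**  Let `J k` (`k ≤ m`) be linear subspaces of
degree-`k` forms.  If `J` is stable (`D ↦ linSubst Mᵀ D`) under every invertible `M` satisfying the
crux's conditions (a) triangularity for `rk`, (b) own columns diagonal, (c) rank-one `Y`-diagonal and
(d) character `= 1`, then it is stable under every invertible `M` satisfying (a), (b), (c) alone.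
Proof: `χ(M) := M₀₀^(m-n) ∏_{i∈Y} M_{(i,i)(i,i)} ≠ 0`; pick `c` with `c^m = χ(M)⁻¹`; `c • M` satisfies
(a)–(d) (the character picks up `c^(m-n) · c^n = c^m`), and `linSubst (c • M)ᵀ D = c^k • linSubst Mᵀ D`.
[folklore] -/
theorem h0Stable_without_character (n m : ℕ) [NeZero m] (hnm : n ≤ m)
    (J : ℕ → Set (MvPolynomial (Fin m × Fin m) ℂ))
    (hsub : ∀ k ≤ m, ∃ Lk : Submodule ℂ (MvPolynomial (Fin m × Fin m) ℂ),
      (Lk : Set (MvPolynomial (Fin m × Fin m) ℂ)) = J k)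
    (hhom : ∀ k ≤ m, ∀ D ∈ J k, D.IsHomogeneous k)
    (hW4 : ∀ A : Matrix.GeneralLinearGroup (Fin m × Fin m) ℂ,
      let M : Matrix (Fin m × Fin m) (Fin m × Fin m) ℂ := A
      let rk := fun (p : Fin m × Fin m) =>
        (if (m - n ≤ (p.1 : ℕ) ∧ m - n ≤ (p.2 : ℕ)) ∨ p = (0, 0) then 0 else m * m) + ((p.1 : ℕ) * m + (p.2 : ℕ))
      (∀ i j : Fin m × Fin m, M j i ≠ 0 → rk j ≤ rk i) →
      (∀ i j : Fin m × Fin m, ((m - n ≤ (i.1 : ℕ) ∧ m - n ≤ (i.2 : ℕ)) ∨ i = (0, 0)) → j ≠ i → M j i = 0) →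
      (∀ i k j l : Fin m, m - n ≤ (i : ℕ) → m - n ≤ (k : ℕ) → m - n ≤ (j : ℕ) → m - n ≤ (l : ℕ) →
        M (i, j) (i, j) * M (k, l) (k, l) = M (i, l) (i, l) * M (k, j) (k, j)) →
      M (0, 0) (0, 0) ^ (m - n) * ∏ i ∈ Finset.univ.filter (fun i : Fin m => m - n ≤ (i : ℕ)), M (i, i) (i, i) = 1 →
      ∀ k ≤ m, ∀ D ∈ J k, linSubst (Fin m × Fin m) ℂ Mᵀ D ∈ J k) :
    ∀ A : Matrix.GeneralLinearGroup (Fin m × Fin m) ℂ,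
      let M : Matrix (Fin m × Fin m) (Fin m × Fin m) ℂ := A
      let rk := fun (p : Fin m × Fin m) =>
        (if (m - n ≤ (p.1 : ℕ) ∧ m - n ≤ (p.2 : ℕ)) ∨ p = (0, 0) then 0 else m * m) + ((p.1 : ℕ) * m + (p.2 : ℕ))
      (∀ i j : Fin m × Fin m, M j i ≠ 0 → rk j ≤ rk i) →
      (∀ i j : Fin m × Fin m, ((m - n ≤ (i.1 : ℕ) ∧ m - n ≤ (i.2 : ℕ)) ∨ i = (0, 0)) → j ≠ i → M j i = 0) →
      (∀ i k j l : Fin m, m - n ≤ (i : ℕ) → m - n ≤ (k : ℕ) → m - n ≤ (j : ℕ) → m - n ≤ (l : ℕ) →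
        M (i, j) (i, j) * M (k, l) (k, l) = M (i, l) (i, l) * M (k, j) (k, j)) →
      ∀ k ≤ m, ∀ D ∈ J k, linSubst (Fin m × Fin m) ℂ Mᵀ D ∈ J k := by
  intro A M rk ha hb hc1 k hk D hD
  have hmpos : 0 < m := Nat.pos_of_ne_zero (NeZero.ne m)
  -- own diagonal entries of an invertible `M` are non-zero
  have hdetM : (M : Matrix (Fin m × Fin m) (Fin m × Fin m) ℂ).det ≠ 0 :=
    (Matrix.isUnits_det_units A).ne_zero
  have hdiag : ∀ i : Fin m × Fin m, ((m - n ≤ (i.1 : ℕ) ∧ m - n ≤ (i.2 : ℕ)) ∨ i = (0, 0)) → M i i ≠ 0 := by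
    intro i hi h0
    apply hdetM
    refine Matrix.det_eq_zero_of_column_eq_zero i fun j => ?_
    by_cases hji : j = i
    · rw [hji]; exact h0
    · exact hb i j hi hji
  -- the character value and its `m`-th root
  set χ : ℂ := M (0, 0) (0, 0) ^ (m - n) *
    ∏ i ∈ Finset.univ.filter (fun i : Fin m => m - n ≤ (i : ℕ)), M (i, i) (i, i) with hχ
  have hχne : χ ≠ 0 := by
    refine mul_ne_zero (pow_ne_zero _ (hdiag (0, 0) (Or.inr rfl))) ?_
    refine Finset.prod_ne_zero_iff.2 fun i hi => hdiag (i, i) (Or.inl ?_)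
    have := (Finset.mem_filter.1 hi).2
    exact ⟨this, this⟩
  obtain ⟨c, hc⟩ := IsAlgClosed.exists_pow_nat_eq χ⁻¹ hmpos
  have hcne : c ≠ 0 := by
    rintro rfl
    rw [zero_pow hmpos.ne'] at hc
    exact inv_ne_zero hχne hc.symm
  -- the rescaled matrix `c • M` is invertible
  have hdet' : (c • (M : Matrix (Fin m × Fin m) (Fin m × Fin m) ℂ)).det ≠ 0 := by
    rw [Matrix.det_smul]
    exact mul_ne_zero (pow_ne_zero _ hcne) hdetM
  set A' : Matrix.GeneralLinearGroup (Fin m × Fin m) ℂ := Matrix.GeneralLinearGroup.mkOfDetNeZero _ hdet'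
    with hA'
  have hA'coe : ((A' : Matrix.GeneralLinearGroup (Fin m × Fin m) ℂ) : Matrix (Fin m × Fin m) (Fin m × Fin m) ℂ)
      = c • M := rfl
  -- apply W4 to `c • M`
  have key := hW4 A'
  simp only [hA'coe, Matrix.smul_apply, smul_eq_mul] at key
  have hmem := key
    (fun i j hij => ha i j (right_ne_zero_of_mul hij))
    (fun i j hi hji => by rw [hb i j hi hji, mul_zero])
    (fun i k' j l hi hk' hj hl => by
      have := hc1 i k' j l hi hk' hj hl
      calc c * M (i, j) (i, j) * (c * M (k', l) (k', l))
          = c * c * (M (i, j) (i, j) * M (k', l) (k', l)) := by ring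
        _ = c * c * (M (i, l) (i, l) * M (k', j) (k', j)) := by rw [this]
        _ = c * M (i, l) (i, l) * (c * M (k', j) (k', j)) := by ring)
    (by
      rw [mul_pow, Finset.prod_mul_distrib, Finset.prod_const, card_filter_block n m hnm]
      calc c ^ (m - n) * M (0, 0) (0, 0) ^ (m - n) *
            (c ^ n * ∏ i ∈ Finset.univ.filter (fun i : Fin m => m - n ≤ (i : ℕ)), M (i, i) (i, i))
          = c ^ (m - n + n) * χ := by rw [hχ, pow_add]; ring
        _ = 1 := by rw [Nat.sub_add_cancel hnm, hc, inv_mul_cancel₀ hχne])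
    k hk D hD
  -- `linSubst (c • M)ᵀ D = c^k • linSubst Mᵀ D`
  have hsmul : linSubst (Fin m × Fin m) ℂ (c • (M : Matrix (Fin m × Fin m) (Fin m × Fin m) ℂ))ᵀ D =
      c ^ k • linSubst (Fin m × Fin m) ℂ Mᵀ D := by
    rw [Matrix.transpose_smul, linSubst_smul_of_isHomogeneous c _ (hhom k hk D hD)]
  have hmem' : c ^ k • linSubst (Fin m × Fin m) ℂ Mᵀ D ∈ J k := by
    have : (c • (M : Matrix (Fin m × Fin m) (Fin m × Fin m) ℂ))ᵀ =
        (fun i j => c * M j i : Matrix (Fin m × Fin m) (Fin m × Fin m) ℂ) := by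
      ext i j; rfl
    rw [← hsmul, this]
    exact hmem
  obtain ⟨Lk, hLk⟩ := hsub k hk
  rw [← hLk, SetLike.mem_coe] at hmem' ⊢
  have := Lk.smul_mem (c ^ k)⁻¹ hmem'
  rwa [smul_smul, inv_mul_cancel₀ (pow_ne_zero _ hcne), one_smul] at this

/-- The same for a Kuratowski limit `J` of annihilator spaces (`IsBorderApolarLimit m P J`, any
sequence `P`): its pieces `J k`, `k ≤ m`, are subspaces of degree-`k` forms
(`exists_submodule_coe_eq`, `IsBorderApolarLimit.isHomogeneous_of_mem`), so W4 with the character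
clause implies W4 without it. [folklore] -/
theorem h0Stable_without_character_of_isBorderApolarLimit (n m : ℕ) [NeZero m] (hnm : n ≤ m)
    (P : ℕ → MvPolynomial (Fin m × Fin m) ℂ) (J : ℕ → Set (MvPolynomial (Fin m × Fin m) ℂ))
    (hJ : IsBorderApolarLimit m P J)
    (hW4 : ∀ A : Matrix.GeneralLinearGroup (Fin m × Fin m) ℂ,
      let M : Matrix (Fin m × Fin m) (Fin m × Fin m) ℂ := A
      let rk := fun (p : Fin m × Fin m) =>
        (if (m - n ≤ (p.1 : ℕ) ∧ m - n ≤ (p.2 : ℕ)) ∨ p = (0, 0) then 0 else m * m) + ((p.1 : ℕ) * m + (p.2 : ℕ))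
      (∀ i j : Fin m × Fin m, M j i ≠ 0 → rk j ≤ rk i) →
      (∀ i j : Fin m × Fin m, ((m - n ≤ (i.1 : ℕ) ∧ m - n ≤ (i.2 : ℕ)) ∨ i = (0, 0)) → j ≠ i → M j i = 0) →
      (∀ i k j l : Fin m, m - n ≤ (i : ℕ) → m - n ≤ (k : ℕ) → m - n ≤ (j : ℕ) → m - n ≤ (l : ℕ) →
        M (i, j) (i, j) * M (k, l) (k, l) = M (i, l) (i, l) * M (k, j) (k, j)) →
      M (0, 0) (0, 0) ^ (m - n) * ∏ i ∈ Finset.univ.filter (fun i : Fin m => m - n ≤ (i : ℕ)), M (i, i) (i, i) = 1 →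
      ∀ k ≤ m, ∀ D ∈ J k, linSubst (Fin m × Fin m) ℂ Mᵀ D ∈ J k) :
    ∀ A : Matrix.GeneralLinearGroup (Fin m × Fin m) ℂ,
      let M : Matrix (Fin m × Fin m) (Fin m × Fin m) ℂ := A
      let rk := fun (p : Fin m × Fin m) =>
        (if (m - n ≤ (p.1 : ℕ) ∧ m - n ≤ (p.2 : ℕ)) ∨ p = (0, 0) then 0 else m * m) + ((p.1 : ℕ) * m + (p.2 : ℕ))
      (∀ i j : Fin m × Fin m, M j i ≠ 0 → rk j ≤ rk i) →
      (∀ i j : Fin m × Fin m, ((m - n ≤ (i.1 : ℕ) ∧ m - n ≤ (i.2 : ℕ)) ∨ i = (0, 0)) → j ≠ i → M j i = 0) →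
      (∀ i k j l : Fin m, m - n ≤ (i : ℕ) → m - n ≤ (k : ℕ) → m - n ≤ (j : ℕ) → m - n ≤ (l : ℕ) →
        M (i, j) (i, j) * M (k, l) (k, l) = M (i, l) (i, l) * M (k, j) (k, j)) →
      ∀ k ≤ m, ∀ D ∈ J k, linSubst (Fin m × Fin m) ℂ Mᵀ D ∈ J k := by
  classical
  refine h0Stable_without_character n m hnm J (fun k hk => ?_)
    (fun k hk D hD => hJ.isHomogeneous_of_mem hk hD) hW4
  have hA : ∀ t : ℕ, ∃ A : Submodule ℂ (MvPolynomial (Fin m × Fin m) ℂ),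
      (A : Set (MvPolynomial (Fin m × Fin m) ℂ)) = annihilatorOfDegree (P t) k := fun t => by
    obtain ⟨A, hA, -, -⟩ := exists_annSubmodule k (P t)
    exact ⟨A, hA⟩
  choose A hA using hA
  refine exists_submodule_coe_eq A (J k) ?_ ?_
  · intro D hD
    obtain ⟨Ds, hDs, hlim⟩ := hJ.1 k hk D hD
    refine ⟨Ds, fun t => ?_, hlim⟩
    rw [← SetLike.mem_coe, hA t, mem_annihilatorOfDegree_iff]
    exact hDs t
  · intro D φ Ds hφ hDs hlim
    refine hJ.2 k hk D φ Ds hφ (fun t => ?_) hlim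
    have h := hDs t
    rw [← SetLike.mem_coe, hA (φ t), mem_annihilatorOfDegree_iff] at h
    exact h

end Summit.ValiantsHypothesis.Cruxes.ToricFixedPoints.Negative
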